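import Summits.QuantumAdvantage.QuantumAdvantage.Theorems.CubicForrelationNearExactIsExactTwelveBetaCosets
import Summits.QuantumAdvantage.QuantumAdvantage.Theorems.CubicForrelationNearExactIsExactSixteenLevelSeven
import Summits.QuantumAdvantage.QuantumAdvantage.Theorems.CubicForrelationNearExactIsExactFlatRadicalPrep

/-!
# Crux `CubicForrelation.NearExactIsExact` (stmt-QuantumAdvantage-14043) — n = 12, configuration (β): NO FOUR of the six fibres of the even set
  have representatives summing into the period group (the six fibre labels in `𝔽₂¹²/P` contain no affine 2-flat)

Certificate seat `b2b-cforr-cert` (gen 25).  HONEST FRAMING: a finite-slice structure lemma (standard axioms) about cubic Boolean functions on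
12 bits — STEP 1 of the (β) × (β) kill at `Φ = 29/32` (HOME/b2b-cforr-cert-g25/PLAN-N12-928-BETA.md, "BREAKTHROUGH"); it claims NO value of
`θ₁₂`.  NOT summit progress.

`tbl_no_four`: with `Z = {u'' even} = ⊔ᵢ mᵢ ⊕ P` as in `tbc_fibres`: `m₁ ⊕ m₂ ⊕ m₃ ⊕ m₄ ∉ P` (any four, by relabelling the symmetric
hypotheses).  Proof: if also `m₁ ⊕ m₂ ⊕ m₅ ⊕ m₆ ∈ P` then `m₁ ⊕ m₂` is a period of `Z`, absurd; otherwise take `u₁ = m₁ ⊕ m₂` and three further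
directions whose fifteen non-trivial combinations avoid `V₈ = P ∪ (m₅ ⊕ m₆ ⊕ P)` (counting); the parametrised 4-flat `m₅ ⊕ ⟨u⟩` meets `Z` in
`m₅` plus pairs `{y, y ⊕ u₁}` (the union of the first four fibres is `u₁`-stable), i.e. in an ODD number of points — but a cubic support
(`[u'' odd] ⊕ 1`, Walsh tower) meets every parametrised 4-flat evenly (`sl_sum_sZ_flat`, `k = 4`).

References: MacWilliams–Sloane (1977) Ch. 13 §3, Ch. 15; R. O'Donnell (2014) §1.4.  Axioms: the standard three.
-/

set_option linter.dupNamespace false -- D-0017: single-problem summit ⇒ `QuantumAdvantage.QuantumAdvantage` by design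

noncomputable section

namespace Summit.QuantumAdvantage.QuantumAdvantage.Theorems.CubicForrelation.NearExactIsExact

open Finset
open Literature.Computability.QuantumComplexity
open Literature.Computability.QuantumComplexity.BuzetChailloux (bxor zeroVec bxor_bxor_cancel_left bxor_zeroVec zeroVec_bxor bxor_comm
  bxor_self)
open Literature.Computability.QuantumComplexity.DerivativeWalsh (W)

/-- **No four fibre labels are affinely dependent — core, named form.**  Six points of `Z`, one per fibre (`hcov`), with the five
pair conditions actually used; conclusion `m₁ ⊕ m₂ ⊕ m₃ ⊕ m₄ ∉ P`.  See the module docstring. [this work] -/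
theorem tbl_no_four_core (g : (Fin (6 + 6) → Bool) → Bool) (hg : IsDegLeFun 3 g)
    (u'' : (Fin (6 + 6) → Bool) → ℤ) (hu'' : ∀ x, W (fun y => signOf (g y)) x = (2 : ℝ) ^ 6 * (u'' x : ℝ))
    (h768 : #(univ.filter fun x : Fin (6 + 6) → Bool => ¬ Odd (u'' x)) = 768)
    (m₁ m₂ m₃ m₄ m₅ m₆ : Fin (6 + 6) → Bool)
    (hm₁ : m₁ ∈ (univ.filter fun x : Fin (6 + 6) → Bool => ¬ Odd (u'' x)))
    (hm₂ : m₂ ∈ (univ.filter fun x : Fin (6 + 6) → Bool => ¬ Odd (u'' x)))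
    (hm₃ : m₃ ∈ (univ.filter fun x : Fin (6 + 6) → Bool => ¬ Odd (u'' x)))
    (hm₄ : m₄ ∈ (univ.filter fun x : Fin (6 + 6) → Bool => ¬ Odd (u'' x)))
    (hm₅ : m₅ ∈ (univ.filter fun x : Fin (6 + 6) → Bool => ¬ Odd (u'' x)))
    (hm₆ : m₆ ∈ (univ.filter fun x : Fin (6 + 6) → Bool => ¬ Odd (u'' x)))
    (d12 : bxor m₁ m₂ ∉ (univ.filter fun a : Fin (6 + 6) → Bool => ∀ x, decide (Odd (u'' (bxor x a))) = decide (Odd (u'' x))))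
    (d15 : bxor m₁ m₅ ∉ (univ.filter fun a : Fin (6 + 6) → Bool => ∀ x, decide (Odd (u'' (bxor x a))) = decide (Odd (u'' x))))
    (d25 : bxor m₂ m₅ ∉ (univ.filter fun a : Fin (6 + 6) → Bool => ∀ x, decide (Odd (u'' (bxor x a))) = decide (Odd (u'' x))))
    (d35 : bxor m₃ m₅ ∉ (univ.filter fun a : Fin (6 + 6) → Bool => ∀ x, decide (Odd (u'' (bxor x a))) = decide (Odd (u'' x))))
    (d45 : bxor m₄ m₅ ∉ (univ.filter fun a : Fin (6 + 6) → Bool => ∀ x, decide (Odd (u'' (bxor x a))) = decide (Odd (u'' x))))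
    (hcov : ∀ x ∈ (univ.filter fun x : Fin (6 + 6) → Bool => ¬ Odd (u'' x)),
      bxor m₁ x ∈ (univ.filter fun a : Fin (6 + 6) → Bool => ∀ x, decide (Odd (u'' (bxor x a))) = decide (Odd (u'' x))) ∨
      bxor m₂ x ∈ (univ.filter fun a : Fin (6 + 6) → Bool => ∀ x, decide (Odd (u'' (bxor x a))) = decide (Odd (u'' x))) ∨
      bxor m₃ x ∈ (univ.filter fun a : Fin (6 + 6) → Bool => ∀ x, decide (Odd (u'' (bxor x a))) = decide (Odd (u'' x))) ∨
      bxor m₄ x ∈ (univ.filter fun a : Fin (6 + 6) → Bool => ∀ x, decide (Odd (u'' (bxor x a))) = decide (Odd (u'' x))) ∨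
      bxor m₅ x ∈ (univ.filter fun a : Fin (6 + 6) → Bool => ∀ x, decide (Odd (u'' (bxor x a))) = decide (Odd (u'' x))) ∨
      bxor m₆ x ∈ (univ.filter fun a : Fin (6 + 6) → Bool => ∀ x, decide (Odd (u'' (bxor x a))) = decide (Odd (u'' x)))) :
    bxor (bxor m₁ m₂) (bxor m₃ m₄) ∉ (univ.filter fun a : Fin (6 + 6) → Bool => ∀ x, decide (Odd (u'' (bxor x a))) = decide (Odd (u'' x))) := by
  classical
  set Z := univ.filter (fun x : Fin (6 + 6) → Bool => ¬ Odd (u'' x)) with hZdef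
  set P := (univ.filter fun a : Fin (6 + 6) → Bool => ∀ x, decide (Odd (u'' (bxor x a))) = decide (Odd (u'' x))) with hPdef
  have hPadd := tbc_P_add u''
  have hP0 := tbc_P_zero u''
  have hP : #P = 128 := tbc_card_P g hg u'' hu'' h768
  intro hdep
  -- xor bookkeeping: membership in `P` is invariant under rewriting the vector
  have Pcongr : ∀ {a b : Fin (6 + 6) → Bool}, a = b → a ∈ P → b ∈ P := fun h ha => h ▸ ha
  -- membership in `Z` via the fibres
  have hZiff : ∀ x, x ∈ Z ↔ (bxor m₁ x ∈ P ∨ bxor m₂ x ∈ P ∨ bxor m₃ x ∈ P ∨ bxor m₄ x ∈ P ∨ bxor m₅ x ∈ P ∨ bxor m₆ x ∈ P) := by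
    intro x
    refine ⟨hcov x, fun h => ?_⟩
    have back : ∀ m, m ∈ Z → bxor m x ∈ P → x ∈ Z := fun m hm hmx => by
      have := tbc_Z_stable u'' hm hmx; rwa [bxor_bxor_cancel_left] at this
    rcases h with h | h | h | h | h | h
    · exact back m₁ hm₁ h
    · exact back m₂ hm₂ h
    · exact back m₃ hm₃ h
    · exact back m₄ hm₄ h
    · exact back m₅ hm₅ h
    · exact back m₆ hm₆ h
  set δ := bxor m₁ m₂ with hδ
  by_cases hB : bxor (bxor m₁ m₂) (bxor m₅ m₆) ∈ P
  · -- CASE A: `δ = m₁ ⊕ m₂` is a period of `Z`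
    apply d12
    refine mem_filter.2 ⟨mem_univ _, fun x => ?_⟩
    -- `x ∈ Z ↔ x ⊕ δ ∈ Z`
    have key : ∀ x, x ∈ Z → bxor x δ ∈ Z := by
      intro x hx
      rw [hZiff] at hx ⊢
      rcases hx with h | h | h | h | h | h
      · right; left; refine Pcongr ?_ h; funext j; simp only [bxor, δ]; cases m₁ j <;> cases m₂ j <;> cases x j <;> rfl
      · left; refine Pcongr ?_ h; funext j; simp only [bxor, δ]; cases m₁ j <;> cases m₂ j <;> cases x j <;> rfl
      · right; right; right; left
        refine Pcongr ?_ (hPadd _ h _ hdep); funext j; simp only [bxor, δ]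
        cases m₁ j <;> cases m₂ j <;> cases m₃ j <;> cases m₄ j <;> cases x j <;> rfl
      · right; right; left
        refine Pcongr ?_ (hPadd _ h _ hdep); funext j; simp only [bxor, δ]
        cases m₁ j <;> cases m₂ j <;> cases m₃ j <;> cases m₄ j <;> cases x j <;> rfl
      · right; right; right; right; right
        refine Pcongr ?_ (hPadd _ h _ hB); funext j; simp only [bxor, δ]
        cases m₁ j <;> cases m₂ j <;> cases m₅ j <;> cases m₆ j <;> cases x j <;> rfl
      · right; right; right; right; left
        refine Pcongr ?_ (hPadd _ h _ hB); funext j; simp only [bxor, δ]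
        cases m₁ j <;> cases m₂ j <;> cases m₅ j <;> cases m₆ j <;> cases x j <;> rfl
    have hiff : x ∈ Z ↔ bxor x δ ∈ Z := by
      refine ⟨key x, fun h => ?_⟩
      have := key _ h
      rwa [iw_bxor_assoc, bxor_self, bxor_zeroVec] at this
    simp only [hZdef, mem_filter, mem_univ, true_and] at hiff
    by_cases ho : Odd (u'' x)
    · have ho' : Odd (u'' (bxor x δ)) := by by_contra h; exact (hiff.2 h) ho
      rw [decide_eq_true ho, decide_eq_true ho']
    · have ho' : ¬ Odd (u'' (bxor x δ)) := hiff.1 ho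
      rw [decide_eq_false ho, decide_eq_false ho']
  · -- CASE B: a 4-flat through `m₅` meeting `Z` oddly
    -- the set to avoid: `V₈ = P ∪ (m₅ ⊕ m₆) ⊕ P`
    set V₈ := P ∪ P.image (bxor (bxor m₅ m₆)) with hV₈
    have hV₈card : #V₈ ≤ 256 := (card_union_le _ _).trans (by rw [hP]; exact Nat.add_le_add_left (card_image_le.trans hP.le) _)
    have hmemV : ∀ t, t ∉ V₈ → t ∉ P ∧ bxor (bxor m₅ m₆) t ∉ P := by
      intro t ht
      rw [hV₈, mem_union, not_or] at ht
      exact ⟨ht.1, fun h => ht.2 (mem_image.2 ⟨bxor (bxor m₅ m₆) t, h, bxor_bxor_cancel_left _ _⟩)⟩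
    have hshift : ∀ (w s : Fin (6 + 6) → Bool), w ∉ V₈.image (fun z => bxor z s) → bxor w s ∉ V₈ := by
      intro w s hw hmem
      exact hw (mem_image.2 ⟨bxor w s, hmem, by rw [iw_bxor_assoc, bxor_self, bxor_zeroVec]⟩)
    have hcardim : ∀ s, #(V₈.image (fun z => bxor z s)) ≤ 256 := fun s => card_image_le.trans hV₈card
    have huniv : #(univ : Finset (Fin (6 + 6) → Bool)) = 4096 := by
      rw [card_univ, Fintype.card_fun, Fintype.card_bool, Fintype.card_fin]; norm_num
    -- `u₁ = δ ∉ V₈`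
    have hu₁ : δ ∉ V₈ := by
      rw [hV₈, mem_union, not_or]
      refine ⟨d12, fun h => hB ?_⟩
      obtain ⟨p, hp, hpe⟩ := mem_image.1 h
      refine Pcongr ?_ hp
      funext j; have := congrFun hpe j; simp only [bxor, δ] at this ⊢; revert this
      cases m₁ j <;> cases m₂ j <;> cases m₅ j <;> cases m₆ j <;> cases p j <;> decide
    -- three more directions
    obtain ⟨u₂, -, hu₂⟩ : ∃ t, t ∈ univ ∧ t ∉ V₈ ∪ V₈.image (fun z => bxor z δ) :=
      exists_mem_notMem_of_card_lt_card (by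
        have h1 := card_union_le V₈ (V₈.image (fun z => bxor z δ)); have h2 := hcardim δ; rw [huniv]; omega)
    rw [mem_union, not_or] at hu₂
    obtain ⟨u₃, -, hu₃⟩ : ∃ t, t ∈ univ ∧ t ∉ (V₈ ∪ V₈.image (fun z => bxor z δ)) ∪ (V₈.image (fun z => bxor z u₂) ∪ V₈.image (fun z => bxor z (bxor u₂ δ))) :=
      exists_mem_notMem_of_card_lt_card (by
        have h1 := card_union_le (V₈ ∪ V₈.image (fun z => bxor z δ)) (V₈.image (fun z => bxor z u₂) ∪ V₈.image (fun z => bxor z (bxor u₂ δ)))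
        have h2 := card_union_le V₈ (V₈.image (fun z => bxor z δ))
        have h3 := card_union_le (V₈.image (fun z => bxor z u₂)) (V₈.image (fun z => bxor z (bxor u₂ δ)))
        have h4 := hcardim δ; have h5 := hcardim u₂; have h6 := hcardim (bxor u₂ δ)
        rw [huniv]; omega)
    simp only [mem_union, not_or] at hu₃
    obtain ⟨u₄, -, hu₄⟩ : ∃ t, t ∈ univ ∧ t ∉ ((V₈ ∪ V₈.image (fun z => bxor z δ)) ∪ (V₈.image (fun z => bxor z u₂) ∪ V₈.image (fun z => bxor z (bxor u₂ δ)))) ∪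
        ((V₈.image (fun z => bxor z u₃) ∪ V₈.image (fun z => bxor z (bxor u₃ δ))) ∪
         (V₈.image (fun z => bxor z (bxor u₃ u₂)) ∪ V₈.image (fun z => bxor z (bxor (bxor u₃ u₂) δ)))) :=
      exists_mem_notMem_of_card_lt_card (by
        have h1 := card_union_le ((V₈ ∪ V₈.image (fun z => bxor z δ)) ∪ (V₈.image (fun z => bxor z u₂) ∪ V₈.image (fun z => bxor z (bxor u₂ δ))))
          ((V₈.image (fun z => bxor z u₃) ∪ V₈.image (fun z => bxor z (bxor u₃ δ))) ∪
           (V₈.image (fun z => bxor z (bxor u₃ u₂)) ∪ V₈.image (fun z => bxor z (bxor (bxor u₃ u₂) δ))))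
        have h2 := card_union_le (V₈ ∪ V₈.image (fun z => bxor z δ)) (V₈.image (fun z => bxor z u₂) ∪ V₈.image (fun z => bxor z (bxor u₂ δ)))
        have h3 := card_union_le V₈ (V₈.image (fun z => bxor z δ))
        have h4 := card_union_le (V₈.image (fun z => bxor z u₂)) (V₈.image (fun z => bxor z (bxor u₂ δ)))
        have h5 := card_union_le (V₈.image (fun z => bxor z u₃) ∪ V₈.image (fun z => bxor z (bxor u₃ δ)))
          (V₈.image (fun z => bxor z (bxor u₃ u₂)) ∪ V₈.image (fun z => bxor z (bxor (bxor u₃ u₂) δ)))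
        have h6 := card_union_le (V₈.image (fun z => bxor z u₃)) (V₈.image (fun z => bxor z (bxor u₃ δ)))
        have h7 := card_union_le (V₈.image (fun z => bxor z (bxor u₃ u₂))) (V₈.image (fun z => bxor z (bxor (bxor u₃ u₂) δ)))
        have := hcardim δ; have := hcardim u₂; have := hcardim (bxor u₂ δ); have := hcardim u₃; have := hcardim (bxor u₃ δ)
        have := hcardim (bxor u₃ u₂); have := hcardim (bxor (bxor u₃ u₂) δ)
        rw [huniv]; omega)
    simp only [mem_union, not_or] at hu₄
    -- the fourteen relevant avoidance facts: for `s ∈ {u₂, u₃, u₃u₂, u₄, u₄u₂, u₄u₃, u₄u₃u₂}`: `s ∉ V₈` and `s ⊕ δ ∉ V₈`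
    have a2 : u₂ ∉ V₈ := hu₂.1
    have a2d : bxor u₂ δ ∉ V₈ := hshift _ _ hu₂.2
    have a3 : u₃ ∉ V₈ := hu₃.1.1
    have a3d : bxor u₃ δ ∉ V₈ := hshift _ _ hu₃.1.2
    have a32 : bxor u₃ u₂ ∉ V₈ := hshift _ _ hu₃.2.1
    have a32d : bxor (bxor u₃ u₂) δ ∉ V₈ := by rw [iw_bxor_assoc]; exact hshift _ _ hu₃.2.2
    have a4 : u₄ ∉ V₈ := hu₄.1.1.1
    have a4d : bxor u₄ δ ∉ V₈ := hshift _ _ hu₄.1.1.2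
    have a42 : bxor u₄ u₂ ∉ V₈ := hshift _ _ hu₄.1.2.1
    have a42d : bxor (bxor u₄ u₂) δ ∉ V₈ := by rw [iw_bxor_assoc]; exact hshift _ _ hu₄.1.2.2
    have a43 : bxor u₄ u₃ ∉ V₈ := hshift _ _ hu₄.2.1.1
    have a43d : bxor (bxor u₄ u₃) δ ∉ V₈ := by rw [iw_bxor_assoc]; exact hshift _ _ hu₄.2.1.2
    have a432 : bxor (bxor u₄ u₃) u₂ ∉ V₈ := by rw [iw_bxor_assoc]; exact hshift _ _ hu₄.2.2.1
    have a432d : bxor (bxor (bxor u₄ u₃) u₂) δ ∉ V₈ := by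
      rw [iw_bxor_assoc, iw_bxor_assoc, ← iw_bxor_assoc u₃ u₂ δ]; exact hshift _ _ hu₄.2.2.2
    -- the cubic indicator of `Z` and its sign
    set c : (Fin (6 + 6) → Bool) → Bool := fun x => decide (Odd (u'' x)) ^^ true with hcdef
    have hc : IsDegLeFun 3 c :=
      tb_isDegLeFun_xor_const (stub_walshTower stub_axParity (6 + 6) 6 3 g u'' hg hu'' (by intro k hk hkn; omega)) true
    have hcZ : ∀ x, sZ (c x) = if x ∈ Z then (-1 : ℤ) else 1 := by
      intro x
      by_cases hx : x ∈ Z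
      · rw [if_pos hx]; have : ¬ Odd (u'' x) := (mem_filter.1 hx).2; simp [c, this, sZ]
      · rw [if_neg hx]; have : Odd (u'' x) := by by_contra h; exact hx (mem_filter.2 ⟨mem_univ _, h⟩)
        simp [c, this, sZ]
    -- pairs `{y, y ⊕ δ}` with `y = m₅ ⊕ s`, `s, s ⊕ δ ∉ V₈`: both in `Z` or both not
    have hpair : ∀ s, s ∉ V₈ → bxor s δ ∉ V₈ → (bxor m₅ s ∈ Z ↔ bxor (bxor m₅ s) δ ∈ Z) := by
      -- one direction suffices by symmetry (`(s ⊕ δ) ⊕ δ = s`)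
      have one : ∀ s, s ∉ V₈ → bxor s δ ∉ V₈ → bxor m₅ s ∈ Z → bxor (bxor m₅ s) δ ∈ Z := by
        intro s hs hsd hZs
        obtain ⟨hsP, hs6⟩ := hmemV s hs
        rw [hZiff] at hZs ⊢
        rcases hZs with h | h | h | h | h | h
        · right; left; refine Pcongr ?_ h; funext j; simp only [bxor, δ]; cases m₁ j <;> cases m₂ j <;> cases m₅ j <;> cases s j <;> rfl
        · left; refine Pcongr ?_ h; funext j; simp only [bxor, δ]; cases m₁ j <;> cases m₂ j <;> cases m₅ j <;> cases s j <;> rfl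
        · right; right; right; left
          refine Pcongr ?_ (hPadd _ h _ hdep); funext j; simp only [bxor, δ]
          cases m₁ j <;> cases m₂ j <;> cases m₃ j <;> cases m₄ j <;> cases m₅ j <;> cases s j <;> rfl
        · right; right; left
          refine Pcongr ?_ (hPadd _ h _ hdep); funext j; simp only [bxor, δ]
          cases m₁ j <;> cases m₂ j <;> cases m₃ j <;> cases m₄ j <;> cases m₅ j <;> cases s j <;> rfl
        · exact absurd (Pcongr (by rw [bxor_bxor_cancel_left]) h) hsP
        · exfalso; apply hs6; refine Pcongr ?_ h; funext j; simp only [bxor]; cases m₅ j <;> cases m₆ j <;> cases s j <;> rfl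
      intro s hs hsd
      refine ⟨one s hs hsd, fun h => ?_⟩
      have h' := one (bxor s δ) hsd (by rw [iw_bxor_assoc, bxor_self, bxor_zeroVec]; exact hs) (by rw [← iw_bxor_assoc]; exact h)
      rwa [iw_bxor_assoc, iw_bxor_assoc, bxor_self, bxor_zeroVec] at h'
    have hpairF : ∀ s, s ∉ V₈ → bxor s δ ∉ V₈ → sZ (c (bxor m₅ s)) + sZ (c (bxor (bxor m₅ s) δ)) = 2 * sZ (c (bxor m₅ s)) := by
      intro s hs hsd
      rw [hcZ, hcZ]
      by_cases h : bxor m₅ s ∈ Z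
      · rw [if_pos h, if_pos ((hpair s hs hsd).1 h)]; norm_num
      · rw [if_neg h, if_neg (fun h' => h ((hpair s hs hsd).2 h'))]; norm_num
    -- `m₅ ∈ Z`, `m₅ ⊕ δ ∉ Z`
    have hm₅δ : bxor m₅ δ ∉ Z := by
      intro h
      rw [hZiff] at h
      rcases h with h | h | h | h | h | h
      · exact d25 (Pcongr (by funext j; simp only [bxor, δ]; cases m₁ j <;> cases m₂ j <;> cases m₅ j <;> rfl) h)
      · exact d15 (Pcongr (by funext j; simp only [bxor, δ]; cases m₁ j <;> cases m₂ j <;> cases m₅ j <;> rfl) h)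
      · exact d45 (Pcongr (by funext j; simp only [bxor, δ]; cases m₁ j <;> cases m₂ j <;> cases m₃ j <;> cases m₄ j <;> cases m₅ j <;> rfl)
          (hPadd _ h _ hdep))
      · exact d35 (Pcongr (by funext j; simp only [bxor, δ]; cases m₁ j <;> cases m₂ j <;> cases m₃ j <;> cases m₄ j <;> cases m₅ j <;> rfl)
          (hPadd _ h _ hdep))
      · exact d12 (Pcongr (by rw [bxor_bxor_cancel_left]) h)
      · exact hB (Pcongr (by funext j; simp only [bxor, δ]; cases m₁ j <;> cases m₂ j <;> cases m₅ j <;> cases m₆ j <;> rfl) h)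
    -- the 4-flat sum
    obtain ⟨z, hz⟩ := sl_sum_sZ_flat c hc m₅ ![δ, u₂, u₃, u₄]
    have e4 := fr_sum4 (fun y => sZ (c y)) m₅ δ u₂ u₃ u₄
    beta_reduce at e4
    rw [e4] at hz
    norm_num at hz
    -- rewrite the sixteen points as `m₅ ⊕ s` / `(m₅ ⊕ s) ⊕ δ`
    have e1 : sZ (c m₅) = -1 := by rw [hcZ, if_pos hm₅]
    have e2 : sZ (c (bxor m₅ δ)) = 1 := by rw [hcZ, if_neg hm₅δ]
    have r3 : bxor (bxor m₅ u₃) u₂ = bxor m₅ (bxor u₃ u₂) := iw_bxor_assoc _ _ _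
    have r4 : bxor (bxor m₅ u₄) u₂ = bxor m₅ (bxor u₄ u₂) := iw_bxor_assoc _ _ _
    have r5 : bxor (bxor m₅ u₄) u₃ = bxor m₅ (bxor u₄ u₃) := iw_bxor_assoc _ _ _
    have r6 : bxor (bxor m₅ (bxor u₄ u₃)) u₂ = bxor m₅ (bxor (bxor u₄ u₃) u₂) := iw_bxor_assoc _ _ _
    rw [r3, r4, r5, r6] at hz
    have p2 := hpairF u₂ a2 a2d
    have p3 := hpairF u₃ a3 a3d
    have p32 := hpairF (bxor u₃ u₂) a32 a32d
    have p4 := hpairF u₄ a4 a4d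
    have p42 := hpairF (bxor u₄ u₂) a42 a42d
    have p43 := hpairF (bxor u₄ u₃) a43 a43d
    have p432 := hpairF (bxor (bxor u₄ u₃) u₂) a432 a432d
    have v2 := tp_sZ_cases (c (bxor m₅ u₂)); have v3 := tp_sZ_cases (c (bxor m₅ u₃)); have v32 := tp_sZ_cases (c (bxor m₅ (bxor u₃ u₂)))
    have v4 := tp_sZ_cases (c (bxor m₅ u₄)); have v42 := tp_sZ_cases (c (bxor m₅ (bxor u₄ u₂)))
    have v43 := tp_sZ_cases (c (bxor m₅ (bxor u₄ u₃))); have v432 := tp_sZ_cases (c (bxor m₅ (bxor (bxor u₄ u₃) u₂)))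
    have hsum : 2 * z = sZ (c (bxor m₅ u₂)) + sZ (c (bxor m₅ u₃)) + sZ (c (bxor m₅ (bxor u₃ u₂))) + sZ (c (bxor m₅ u₄)) +
        sZ (c (bxor m₅ (bxor u₄ u₂))) + sZ (c (bxor m₅ (bxor u₄ u₃))) + sZ (c (bxor m₅ (bxor (bxor u₄ u₃) u₂))) := by
      linarith
    clear * - hsum v2 v3 v32 v4 v42 v43 v432
    omega

/-- **No four fibre labels are affinely dependent — symmetric form.**  `M` = six points of `Z = {u'' even}`, pairwise in different
`P`-cosets, meeting every `P`-coset of `Z` (`tbc_fibres`); then for any four distinct `a b c d ∈ M`, `a ⊕ b ⊕ c ⊕ d ∉ P`.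
[this work] -/
theorem tbl_no_four (g : (Fin (6 + 6) → Bool) → Bool) (hg : IsDegLeFun 3 g)
    (u'' : (Fin (6 + 6) → Bool) → ℤ) (hu'' : ∀ x, W (fun y => signOf (g y)) x = (2 : ℝ) ^ 6 * (u'' x : ℝ))
    (h768 : #(univ.filter fun x : Fin (6 + 6) → Bool => ¬ Odd (u'' x)) = 768)
    (M : Finset (Fin (6 + 6) → Bool)) (hM6 : #M = 6)
    (hMZ : ∀ a ∈ M, a ∈ (univ.filter fun x : Fin (6 + 6) → Bool => ¬ Odd (u'' x)))
    (hpair : ∀ a ∈ M, ∀ b ∈ M, a ≠ b →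
      bxor a b ∉ (univ.filter fun a : Fin (6 + 6) → Bool => ∀ x, decide (Odd (u'' (bxor x a))) = decide (Odd (u'' x))))
    (hcovM : ∀ x ∈ (univ.filter fun x : Fin (6 + 6) → Bool => ¬ Odd (u'' x)), ∃ a ∈ M,
      bxor a x ∈ (univ.filter fun a : Fin (6 + 6) → Bool => ∀ x, decide (Odd (u'' (bxor x a))) = decide (Odd (u'' x))))
    {a b c d : Fin (6 + 6) → Bool} (ha : a ∈ M) (hb : b ∈ M) (hc : c ∈ M) (hd : d ∈ M)
    (hab : a ≠ b) (hac : a ≠ c) (had : a ≠ d) (hbc : b ≠ c) (hbd : b ≠ d) (hcd : c ≠ d) :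
    bxor (bxor a b) (bxor c d) ∉
      (univ.filter fun a : Fin (6 + 6) → Bool => ∀ x, decide (Odd (u'' (bxor x a))) = decide (Odd (u'' x))) := by
  classical
  -- the two remaining elements `e, f` of `M`
  set R := (((M.erase a).erase b).erase c).erase d with hR
  have hcR : c ∈ (M.erase a).erase b := mem_erase.2 ⟨hbc.symm, mem_erase.2 ⟨hac.symm, hc⟩⟩
  have hdR : d ∈ ((M.erase a).erase b).erase c := mem_erase.2 ⟨hcd.symm, mem_erase.2 ⟨hbd.symm, mem_erase.2 ⟨had.symm, hd⟩⟩⟩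
  have hR2 : #R = 2 := by
    rw [hR, card_erase_of_mem hdR, card_erase_of_mem hcR, card_erase_of_mem (mem_erase.2 ⟨hab.symm, hb⟩),
      card_erase_of_mem ha, hM6]
  obtain ⟨e, f, hef, hRef⟩ := card_eq_two.1 hR2
  have hmemR : ∀ x, x ∈ R ↔ x ≠ d ∧ x ≠ c ∧ x ≠ b ∧ x ≠ a ∧ x ∈ M := fun x => by simp only [hR, mem_erase]
  have heR := (hmemR e).1 (hRef ▸ mem_insert_self _ _)
  have hfR := (hmemR f).1 (hRef ▸ mem_insert_of_mem (mem_singleton_self _))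
  obtain ⟨hed, hec, heb, hea, he⟩ := heR
  obtain ⟨-, -, -, -, hf⟩ := hfR
  have hcases : ∀ x ∈ M, x = a ∨ x = b ∨ x = c ∨ x = d ∨ x = e ∨ x = f := by
    intro x hx
    by_cases xa : x = a
    · exact Or.inl xa
    by_cases xb : x = b
    · exact Or.inr (Or.inl xb)
    by_cases xc : x = c
    · exact Or.inr (Or.inr (Or.inl xc))
    by_cases xd : x = d
    · exact Or.inr (Or.inr (Or.inr (Or.inl xd)))
    have hxR : x ∈ R := (hmemR x).2 ⟨xd, xc, xb, xa, hx⟩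
    rw [hRef, mem_insert, mem_singleton] at hxR
    rcases hxR with h | h
    · exact Or.inr (Or.inr (Or.inr (Or.inr (Or.inl h))))
    · exact Or.inr (Or.inr (Or.inr (Or.inr (Or.inr h))))
  refine tbl_no_four_core g hg u'' hu'' h768 a b c d e f (hMZ _ ha) (hMZ _ hb) (hMZ _ hc) (hMZ _ hd) (hMZ _ he) (hMZ _ hf)
    (hpair _ ha _ hb hab) (hpair _ ha _ he (Ne.symm hea)) (hpair _ hb _ he (Ne.symm heb)) (hpair _ hc _ he (Ne.symm hec))
    (hpair _ hd _ he (Ne.symm hed)) ?_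
  intro x hx
  obtain ⟨a', ha', h⟩ := hcovM x hx
  rcases hcases a' ha' with rfl | rfl | rfl | rfl | rfl | rfl
  · exact Or.inl h
  · exact Or.inr (Or.inl h)
  · exact Or.inr (Or.inr (Or.inl h))
  · exact Or.inr (Or.inr (Or.inr (Or.inl h)))
  · exact Or.inr (Or.inr (Or.inr (Or.inr (Or.inl h))))
  · exact Or.inr (Or.inr (Or.inr (Or.inr (Or.inr h))))

/-- **The six representatives as a set.**  From the list-form output of `tbc_fibres` (fifteen pair conditions) to the symmetric
form used by `tbl_no_four`: `M = {m₁,…,m₆}` has six elements and distinct elements lie in different `P`-cosets. [this work] -/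
theorem tbl_six_set (u'' : (Fin (6 + 6) → Bool) → ℤ) (m₁ m₂ m₃ m₄ m₅ m₆ : Fin (6 + 6) → Bool)
    (hdist : ∀ a b, (a, b) ∈ [(m₁, m₂), (m₁, m₃), (m₁, m₄), (m₁, m₅), (m₁, m₆), (m₂, m₃), (m₂, m₄), (m₂, m₅), (m₂, m₆), (m₃, m₄),
      (m₃, m₅), (m₃, m₆), (m₄, m₅), (m₄, m₆), (m₅, m₆)] →
      bxor a b ∉ (univ.filter fun a : Fin (6 + 6) → Bool => ∀ x, decide (Odd (u'' (bxor x a))) = decide (Odd (u'' x)))) :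
    #({m₁, m₂, m₃, m₄, m₅, m₆} : Finset (Fin (6 + 6) → Bool)) = 6 ∧
    ∀ a ∈ ({m₁, m₂, m₃, m₄, m₅, m₆} : Finset (Fin (6 + 6) → Bool)), ∀ b ∈ ({m₁, m₂, m₃, m₄, m₅, m₆} : Finset (Fin (6 + 6) → Bool)),
      a ≠ b → bxor a b ∉ (univ.filter fun a : Fin (6 + 6) → Bool => ∀ x, decide (Odd (u'' (bxor x a))) = decide (Odd (u'' x))) := by
  classical
  have hP0 := tbc_P_zero u''
  -- distinct vectors: `bxor a a = 0 ∈ P`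
  have hne : ∀ a b, bxor a b ∉ (univ.filter fun a : Fin (6 + 6) → Bool => ∀ x, decide (Odd (u'' (bxor x a))) = decide (Odd (u'' x))) →
      a ≠ b := by
    rintro a b h rfl; rw [bxor_self] at h; exact h hP0
  have d12 := hdist m₁ m₂ (by simp); have d13 := hdist m₁ m₃ (by simp); have d14 := hdist m₁ m₄ (by simp)
  have d15 := hdist m₁ m₅ (by simp); have d16 := hdist m₁ m₆ (by simp); have d23 := hdist m₂ m₃ (by simp)
  have d24 := hdist m₂ m₄ (by simp); have d25 := hdist m₂ m₅ (by simp); have d26 := hdist m₂ m₆ (by simp)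
  have d34 := hdist m₃ m₄ (by simp); have d35 := hdist m₃ m₅ (by simp); have d36 := hdist m₃ m₆ (by simp)
  have d45 := hdist m₄ m₅ (by simp); have d46 := hdist m₄ m₆ (by simp); have d56 := hdist m₅ m₆ (by simp)
  refine ⟨?_, ?_⟩
  · rw [card_insert_of_notMem, card_insert_of_notMem, card_insert_of_notMem, card_insert_of_notMem, card_insert_of_notMem,
      card_singleton]
    · simp only [mem_singleton]; exact hne _ _ d56
    · simp only [mem_insert, mem_singleton, not_or]; exact ⟨hne _ _ d45, hne _ _ d46⟩
    · simp only [mem_insert, mem_singleton, not_or]; exact ⟨hne _ _ d34, hne _ _ d35, hne _ _ d36⟩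
    · simp only [mem_insert, mem_singleton, not_or]; exact ⟨hne _ _ d23, hne _ _ d24, hne _ _ d25, hne _ _ d26⟩
    · simp only [mem_insert, mem_singleton, not_or]; exact ⟨hne _ _ d12, hne _ _ d13, hne _ _ d14, hne _ _ d15, hne _ _ d16⟩
  · intro a ha b hb hab
    simp only [mem_insert, mem_singleton] at ha hb
    rcases ha with rfl | rfl | rfl | rfl | rfl | rfl <;> rcases hb with rfl | rfl | rfl | rfl | rfl | rfl <;>
      first
        | exact absurd rfl hab
        | assumption
        | (rw [bxor_comm]; assumption)

end Summit.QuantumAdvantage.QuantumAdvantage.Theorems.CubicForrelation.NearExactIsExact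

end
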